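import Summits.SmoothPoincare4.SmoothPoincare4.Theorems.SullivanDualWitnessChargeHelperMemberFarCovers
import Summits.SmoothPoincare4.SmoothPoincare4.Theorems.SullivanDualWitnessChargeHelperMemberNearBound
import Summits.SmoothPoincare4.SmoothPoincare4.Theorems.SullivanDualWitnessChargeHelperMemberSlab
import Summits.SmoothPoincare4.SmoothPoincare4.Theorems.SullivanDualWitnessChargeFlatChart
import Mathlib.Analysis.Complex.Basic

/-!
# Helper `helper_limitFar` of line `Sketch` for crux `WitnessCharge`
(item stmt-SmoothPoincare4-7824; route `SullivanDual`, crux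
`Summit.SmoothPoincare4.SmoothPoincare4.Theses.SullivanDual.WitnessCharge`; line `Sketch`,
registered stub `helper_limitFar` of the lead's cycle-2 helper skeleton, wave 3 — (N)-branch,
far structure of the limit)

**The far structure passes to pointwise limits of pencil members.** Let `J` be STANDARD on the
punctured `ε'`-chart-ball `B_{ε'}` at `p` (closed `ε'`-ball inside the chart target), let
`u n : ℂ → Σ∖p` be pencil members (`IsPencilMember J (u n) (b n)`), and let a subsequence
`u (φ k)` converge pointwise on `Σ∖p` to `G : ℂ → Σ∖p`. For `R > ε'⁻¹` and a parameter `ξ` with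
`2R < ‖ξ‖`:

* `G ξ ∈ B_{ε'}`;
* `R ≤ ‖z(G ξ)‖`, `z = (Ycoord p ·).1` the first complex flat coordinate;
* `Ycoord p (u (φ k) ξ) → Ycoord p (G ξ)`.

Proof. By the far-covering property of members (`helper_memberFarCovers`) every
`x_k = u (φ k) ξ` lies in `B_{ε'}` with `R < ‖z(x_k)‖`, uniformly in `k`. The CLOSED chart-ball
`{y ∈ (chartAt p).source | e y ∈ closedBall (e p) ε'}` is closed in `Σ` (it is the continuous image
of a compact ball under `e.symm`; `isClosed_closedChartBall`), it contains every `x_k`, and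
`x_k → G ξ` in `Σ` as well; so `G ξ` lies in it, in particular in the chart source and in the
punctured `(ε' + 1)`-chart-ball, where `Ycoord p` is continuous (`contMDiffAt_Ycoord`). Hence
`Ycoord p x_k → Ycoord p (G ξ)`, so `R ≤ ‖z(G ξ)‖` (`ge_of_tendsto'`), and finally
`‖z(G ξ)‖ ≥ R > ε'⁻¹` forces `‖e (G ξ) − e p‖ < ε'` (`inBall_of_inv_lt_norm_fst_Ycoord`), i.e.
`G ξ ∈ B_{ε'}`. (The limit cannot escape to the puncture because it is taken in `Σ∖p`; the bound
on the intercepts is not needed for this step.)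

Everything here is proved; no facts and no `Prop`-valued definitions are introduced.
-/

noncomputable section

-- the prescribed namespace `Summit.<P>.<Sub>.…` duplicates `SmoothPoincare4` (P = Sub)
set_option linter.dupNamespace false

open scoped Manifold ContDiff Topology
open Set Filter Literature.Geometry.Kaehler Literature.Geometry.Symplectic
  Literature.Topology.FourManifolds

namespace Summit.SmoothPoincare4.SmoothPoincare4.Theorems.WitnessCharge.PencilIncompleteness

/-- **Far structure of the limit (helper `helper_limitFar`, (N)-branch of line `Sketch`).** For `J`
standard on the punctured `ε'`-chart-ball at `p` (closed `ε'`-ball inside the chart target), pencil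
members `u n` of intercepts `b n` and a subsequence `u (φ k)` converging pointwise on `Σ∖p` to `G`:
for `R > ε'⁻¹` and `2R < ‖ξ‖`, the limit point `G ξ` lies in the punctured `ε'`-chart-ball, its
first flat coordinate has norm `≥ R`, and `Ycoord p (u (φ k) ξ) → Ycoord p (G ξ)`. -/
theorem helper_limitFar :
    ∀ (S : HomotopySphere 4) (p : S.carrier)
      (J : ∀ x : punctured p, TangentSpace (𝓡 4) x →L[ℝ] TangentSpace (𝓡 4) x) (ε' : ℝ),
      0 < ε' →
      Metric.closedBall (extChartAt (𝓡 4) p p) ε' ⊆ (extChartAt (𝓡 4) p).target →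
      (∀ x : punctured p, InPuncturedChartBall p ε' x →
        ∀ (v : TangentSpace (𝓡 4) x) (b : EuclideanSpace ℝ (Fin 4)),
          inner ℝ (fderiv ℝ inversion (extChartAt (𝓡 4) p x.1 - extChartAt (𝓡 4) p p)
            (mfderiv (𝓡 4) 𝓘(ℝ, EuclideanSpace ℝ (Fin 4))
              (fun z : punctured p => extChartAt (𝓡 4) p z.1) x (J x v))) b
          = stdSymplecticForm (fderiv ℝ inversion (extChartAt (𝓡 4) p x.1 - extChartAt (𝓡 4) p p)
            (mfderiv (𝓡 4) 𝓘(ℝ, EuclideanSpace ℝ (Fin 4))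
              (fun z : punctured p => extChartAt (𝓡 4) p z.1) x v)) b) →
      ∀ (u : ℕ → ℂ → punctured p) (b : ℕ → ℂ) (B : ℝ) (G : ℂ → punctured p) (φ : ℕ → ℕ),
        (∀ n, IsPencilMember J (u n) (b n)) → (∀ n, ‖b n‖ ≤ B) →
        (∀ ξ : ℂ, Tendsto (fun k => u (φ k) ξ) atTop (𝓝 (G ξ))) →
        ∀ R : ℝ, ε'⁻¹ < R → ∀ ξ : ℂ, 2 * R < ‖ξ‖ →
          InPuncturedChartBall p ε' (G ξ) ∧ R ≤ ‖(Ycoord p (G ξ)).1‖ ∧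
          Tendsto (fun k => Ycoord p (u (φ k) ξ)) atTop (𝓝 (Ycoord p (G ξ))) := by
  intro S p J ε' hε' hball hJstd u b _B G φ hu _hB hpt R hR ξ hξ
  -- uniform far structure of the members at the parameter `ξ` (`helper_memberFarCovers`)
  have hfar : ∀ k : ℕ,
      InPuncturedChartBall p ε' (u (φ k) ξ) ∧ R < ‖(Ycoord p (u (φ k) ξ)).1‖ := fun k =>
    helper_memberFarCovers S p J ε' (u (φ k)) (b (φ k)) hε' hball hJstd (hu (φ k)) R hR ξ hξ
  -- the closed `ε'`-chart-ball is closed in `Σ` and contains every `u (φ k) ξ`, so the limit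
  -- (taken in `Σ ∖ p`, hence also in `Σ`) stays in it
  have hlim : (G ξ).1 ∈ {y : S.carrier | y ∈ (chartAt (EuclideanSpace ℝ (Fin 4)) p).source ∧
      extChartAt (𝓡 4) p y ∈ Metric.closedBall (extChartAt (𝓡 4) p p) ε'} :=
    (isClosed_closedChartBall p hball).mem_of_tendsto
      ((continuous_subtype_val.tendsto (G ξ)).comp (hpt ξ))
      (Eventually.of_forall fun k => ⟨(hfar k).1.1, Metric.ball_subset_closedBall (hfar k).1.2⟩)
  -- hence the limit lies in the punctured `(ε' + 1)`-chart-ball, where `Ycoord p` is continuous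
  have hbig : InPuncturedChartBall p (ε' + 1) (G ξ) :=
    ⟨hlim.1, Metric.closedBall_subset_ball (lt_add_one ε') hlim.2⟩
  have hT : Tendsto (fun k => Ycoord p (u (φ k) ξ)) atTop (𝓝 (Ycoord p (G ξ))) :=
    (contMDiffAt_Ycoord hbig).continuousAt.tendsto.comp (hpt ξ)
  -- the strict far inequality passes to the limit as a weak one
  have hRle : R ≤ ‖(Ycoord p (G ξ)).1‖ := ge_of_tendsto' hT.fst_nhds.norm fun k => (hfar k).2.le
  -- and `‖z(G ξ)‖ ≥ R > ε'⁻¹` puts `G ξ` back into the punctured `ε'`-chart-ball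
  exact ⟨inBall_of_inv_lt_norm_fst_Ycoord hbig hε' (hR.trans_le hRle), hRle, hT⟩

end Summit.SmoothPoincare4.SmoothPoincare4.Theorems.WitnessCharge.PencilIncompleteness
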